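import Summits.CriticalPhenomena.PercolationContinuityZ3.Theorems.FK.PressureClusterDensity
import Summits.CriticalPhenomena.PercolationContinuityZ3.Theorems.FK.BoxClusterCountWired
import Summits.CriticalPhenomena.PercolationContinuityZ3.Theorems.FK.ClusterDensityCriterion
import Summits.CriticalPhenomena.PercolationContinuityZ3.Theorems.FK.InfiniteVolumeInvariance
import Literature.Probability.Percolation.SlabCriticalityInputs
import Literature.Probability.LatticeModels.ThermodynamicLimit
import HarnessLib

/-!
# FK-continuity cell, FO-10a: if the pressure is differentiable in `q` then `φ⁰_{p,q} = φ¹_{p,q}`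
# (Grimmett 2006, Lemma (4.79), direction "⇒", with (4.80)–(4.84) and Prop. (4.85) — WITHOUT the ergodic theorem)

Registered R89 (cell INBOX l.6394, 2026-08-24); registry row FO-10a-g338k; label KAP-F (coordinator fk-4 g195).
Cell `fk-continuity` (bschramm), row FO-10a; support file for the FK-continuity transplant
(`--supports stmt-CriticalPhenomena-4575`); builds on p205010 (kernel theorem, internal audit signed;
external expert review pending). Pure proofs; no definitions, no named facts, no sorries; `d ≥ 1`.

Assembly of `PressureClusterDensity.lean` (the `q`-tangent inequalities and the slope sandwich),
`BoxClusterCountFree.lean` / `BoxClusterCountWired.lean` (the free lower / wired upper bounds of the mean number of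
clusters of the box laws by `|Λ_N| κ⁰ − 1` / `|Λ_N| κ¹ + 2`), translation invariance of `φ^b_{p,q}`
(`InfiniteVolumeInvariance.lean`) and Prop. (4.85) (`ClusterDensityCriterion.lean`):

* `integral_inv_ncard_openCluster_rcLimit_eq` — `φ^b_{p,q}(|C_x|⁻¹) = φ^b_{p,q}(|C_0|⁻¹)` for every site `x`;
* `tendsto_inv_card_box` — `1/|Λ_N| → 0` (`d ≥ 1`);
* HEADLINE **`rcLimit_false_eq_rcLimit_true_of_differentiableAt_pressure_q (hd : 0 < d) (hp : p ∈ Ioo 0 1) (hq : 1 ≤ q)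
  (hΦ : ∀ b, ∀ᶠ y in 𝓝 q, |Λ_N|⁻¹ log Z^b_{Λ_N}(p,y) → Φ y) : DifferentiableAt ℝ Φ q → φ⁰_{p,q} = φ¹_{p,q}`** —
  if the per-site box pressures converge to `Φ` near `q` for both boundary conditions (Thm. (4.58); the hypothesis is
  discharged by `PressureThermodynamicLimit.lean`) and `Φ = Φ(p,·)` is differentiable at `q`, then there is a unique
  random-cluster measure at `(p,q)`.

## References
* G. Grimmett, *The Random-Cluster Model*, Springer 2006 (`book:grimmett2006-random-cluster-model`): §4.5,
  Thm. (4.58), Lemma (4.79), (4.80)–(4.84), Prop. (4.85) [PDF pp. 86, 93–95]. [Grimmett2006]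
-/

noncomputable section

open scoped Classical
open Finset Filter Topology MeasureTheory

namespace Summit.CriticalPhenomena.PercolationContinuityZ3.Theorems.FK

open Literature.Probability.Percolation Literature.Probability.LatticeModels

variable {d : ℕ} {p q : ℝ}

/-- **Translation invariance of the cluster density: `φ^b_{p,q}(|C_x|⁻¹) = φ^b_{p,q}(|C_0|⁻¹)`.**
[cite: Grimmett2006, Thm. (4.19)(b)] -/
theorem integral_inv_ncard_openCluster_rcLimit_eq (b : Bool) (hp : p ∈ Set.Icc (0 : ℝ) 1) (hq : 1 ≤ q) (x : Site d) :
    ∫ ω, ((openCluster ω x).ncard : ℝ)⁻¹ ∂(rcLimit d b p q) =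
      ∫ ω, ((openCluster ω (0 : Site d)).ncard : ℝ)⁻¹ ∂(rcLimit d b p q) := by
  have h := (isBoxLimit_rcLimit b hp hq).integral_comp_relabel_shift hp hq x
    (fun ω => (((openCluster ω x).ncard : ℝ))⁻¹)
  rw [← h]
  refine integral_congr_ae (Eventually.of_forall fun ω => ?_)
  have h2 := openCluster_relabel (Site.shift x) ω 0
  rw [Site.shift_apply, zero_add] at h2
  simp only
  rw [h2, Set.ncard_image_of_injective _ (Site.shift x).injective]

/-- `1/|Λ_N| → 0` as `N → ∞` (`d ≥ 1`). [folklore] -/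
theorem tendsto_inv_card_box (hd : 0 < d) : Tendsto (fun N : ℕ => ((#(box d N) : ℝ))⁻¹) atTop (𝓝 0) := by
  refine tendsto_inv_atTop_zero.comp (tendsto_atTop_atTop.2 fun r => ⟨⌈r⌉₊, fun N hN => ?_⟩)
  have h1 : N + 1 ≤ #(box d N) := by
    rw [card_box]
    calc N + 1 ≤ 2 * N + 1 := by omega
      _ ≤ (2 * N + 1) ^ d := Nat.le_self_pow hd.ne' _
  have h2 : r ≤ N := (Nat.le_ceil r).trans (by exact_mod_cast hN)
  have h3 : ((N + 1 : ℕ) : ℝ) ≤ #(box d N) := by exact_mod_cast h1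
  push_cast at h3
  linarith

/-- **Grimmett 2006, Lemma (4.79) "⇒": if the pressure `Φ(p,·)` is differentiable at `q` then `φ⁰_{p,q} = φ¹_{p,q}`**
(`d ≥ 1`, `0 < p < 1`, `q ≥ 1`). Hypothesis: the per-site box pressures converge to `Φ` near `q` for both boundary
conditions (Thm. (4.58), `PressureThermodynamicLimit.lean`). Proof: the `q`-tangent inequalities of the pressure with
the free lower bound `|Λ_N| κ⁰ − 1 ≤ E⁰_{Λ_N}[k]` and the wired upper bound `E¹_{Λ_N}[k] ≤ |Λ_N| κ¹ + 2` squeeze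
`κ⁰/q ≤ Φ'(q) ≤ κ¹/q`; with `κ¹ ≤ κ⁰` this is `κ⁰ = κ¹`, and Prop. (4.85) concludes.
[cite: Grimmett2006, Lemma (4.79), (4.80)–(4.84), Prop. (4.85)] -/
theorem rcLimit_false_eq_rcLimit_true_of_differentiableAt_pressure_q (hd : 0 < d) (hp : p ∈ Set.Ioo (0 : ℝ) 1)
    (hq : 1 ≤ q) {Φ : ℝ → ℝ}
    (hΦ : ∀ b : Bool, ∀ᶠ y in 𝓝 q, Tendsto (fun N : ℕ =>
      Real.log (rcPartitionFunction (finsetGraph (zdGraph d) (box d N)) p y (boxBC d b N)) / #(box d N)) atTop (𝓝 (Φ y)))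
    (hdiff : DifferentiableAt ℝ Φ q) :
    rcLimit d false p q = rcLimit d true p q := by
  have hp' : p ∈ Set.Icc (0 : ℝ) 1 := ⟨hp.1.le, hp.2.le⟩
  have hq0 : 0 < q := one_pos.trans_le hq
  set κ₀ := ∫ ω, ((openCluster ω (0 : Site d)).ncard : ℝ)⁻¹ ∂(rcLimit d false p q) with hκ₀
  set κ₁ := ∫ ω, ((openCluster ω (0 : Site d)).ncard : ℝ)⁻¹ ∂(rcLimit d true p q) with hκ₁
  have hcardpos : ∀ N : ℕ, (0 : ℝ) < #(box d N) := fun N => by exact_mod_cast Finset.card_pos.2 (box_nonempty d N)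
  have hsum : ∀ (b : Bool) (N : ℕ),
      ∑ x : ↥(box d N), ∫ ω, ((openCluster ω (x : Site d)).ncard : ℝ)⁻¹ ∂(rcLimit d b p q) =
        #(box d N) * ∫ ω, ((openCluster ω (0 : Site d)).ncard : ℝ)⁻¹ ∂(rcLimit d b p q) := by
    intro b N
    simp_rw [integral_inv_ncard_openCluster_rcLimit_eq b hp' hq]
    rw [Finset.sum_const, Finset.card_univ, Fintype.card_coe, nsmul_eq_mul]
  -- the free lower bound, per site
  have h₀ : ∀ δ : ℝ, 0 < δ → ∀ᶠ N : ℕ in atTop, κ₀ - δ ≤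
      rcExpect (finsetGraph (zdGraph d) (box d N)) p q (boxBC d false N)
        (fun ω => (clusterCount (↑ω : BondConfig ↥(box d N)) (boxBC d false N) : ℝ)) / #(box d N) := by
    intro δ hδ
    filter_upwards [(tendsto_inv_card_box hd).eventually (eventually_le_nhds hδ)] with N hN
    have h := sum_integral_inv_ncard_sub_one_le_rcExpect_clusterCount hp' hq N (d := d)
    rw [hsum false N] at h
    rw [le_div_iff₀ (hcardpos N)]
    have : δ * #(box d N) ≥ 1 := by
      have h1 : ((#(box d N) : ℝ))⁻¹ ≤ δ := hN
      rw [inv_le_iff_one_le_mul₀ (hcardpos N)] at h1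
      linarith [h1]
    nlinarith [this, h]
  -- the wired upper bound, per site
  have h₁ : ∀ δ : ℝ, 0 < δ → ∀ᶠ N : ℕ in atTop,
      rcExpect (finsetGraph (zdGraph d) (box d N)) p q (boxBC d true N)
        (fun ω => (clusterCount (↑ω : BondConfig ↥(box d N)) (boxBC d true N) : ℝ)) / #(box d N) ≤ κ₁ + δ := by
    intro δ hδ
    filter_upwards [(tendsto_inv_card_box hd).eventually (eventually_le_nhds (half_pos hδ))] with N hN
    have h := rcExpect_clusterCount_true_le_sum_integral_inv_ncard_add_two hd hp' hq N
    rw [hsum true N] at h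
    rw [div_le_iff₀ (hcardpos N)]
    have : δ * #(box d N) ≥ 2 := by
      have h1 : ((#(box d N) : ℝ))⁻¹ ≤ δ / 2 := hN
      rw [inv_le_iff_one_le_mul₀ (hcardpos N)] at h1
      linarith [h1]
    nlinarith [this, h]
  have hle : κ₀ ≤ κ₁ := le_of_differentiableAt_pressure_q hp hq0 hΦ h₀ h₁ hdiff
  have hge : κ₁ ≤ κ₀ := integral_inv_ncard_openCluster_true_le_false hp' hq 0
  exact (rcLimit_false_eq_rcLimit_true_iff_integral_inv_ncard_eq hp' hq 0).2 (le_antisymm hle hge)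

end Summit.CriticalPhenomena.PercolationContinuityZ3.Theorems.FK

end
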